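import Literature.MathematicalPhysics.QuantumFieldTheory.Balaban1983to89.Node00.BgSchemeChartLie
import Literature.MathematicalPhysics.QuantumFieldTheory.Balaban1983to89.Node00.BgSchemeOfRecordC
import Literature.MathematicalPhysics.QuantumFieldTheory.Balaban1983to89.Node00.ShearedAveragingRecordPureGauge
import HarnessLib

/-!
# NODE 00 — `BgSchemeOfRecordLie`: THE LIE READING, THE FLAT VALUE AND THE Cⁿ CHART ENTRIES AT THE SCHEME OF RECORD —
# `chartCfg 1 = 1` at the flat datum, (s-exp) and `hC`∕`hdiff` of the K0 junction at `bgSchemeOfRecord … U₀ …`, by name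

Cell `pub-ymgap` (YM-PLAN Track A), seat `pub-ymgap-node00-def-Y` (g38; custodian of the `BgScheme` instance of record).  The RECORD edition of
`Node00.BgSchemeChartLie` (generic Lie reading `lieExpo`, token `LieTokAt`, seam `chartCfg_eq_expChart_one`, rows socket, flat value, Cⁿ transport)
at the scheme of record `bgSchemeOfRecord F N K k Ω U₀ dom …` of `Node00.BgSchemeOfRecord` (3a) and its complex-datum edition (s1)
`Node00.BgSchemeOfRecordC`.  [B11] = [Balaban1985Variational] (CMP **102** (1985) 277–309).

WHAT (answering ◆ CRIT-1 nodeO l.5250 «`chartCfg S 1 = 1`, C² chart entries at 0», ▶ PTC-1 l.5271, ◇ lens-1 l.5274):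
* §1 the presentation `ev = η·evLit` is CONTINUOUS (finite dimension) and the `ev`-presented real sector is CLOSED — the two analytic premises of the
  generic file, discharged at the record;
* §2 THE FLAT DATUM at the unit background `U₀ = 1`: `Ū^k(1) = 1` (`iter_one` ∕ `avOfRecord_avg_one`), `𝔄(1) = 0` (3a E2 `_𝔄_self`), `J ≡ 0` (3a
  `_J_one`), hence under the displayed `RegimeTok` and `1 ∈ dom`: `𝒜(1) = 0` (`BgScheme.sol_eq_zero`), the Lie token at `1`, `lieExpo 1 = 0`, and
  ★ `chartCfg 1 = 1` — the junction's `h1`;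
* §3 Cⁿ OF THE FULL SMALL FIELD ALONG A DATUM MAP: for `u : E → fields` with `x ↦ coeField (u x)` of class `Cⁿ` at `x₀` and `coeField (u x₀)` in an open
  set `𝒪` of complex data on which (s1)'s `𝒜ᶜ` is analytic and the log-polydisc condition holds, `x ↦ 𝒜(u x) + 𝔄(u x)` is `Cⁿ` at `x₀` (ℂ-analytic ⟹
  real `C^∞`, composed) — with the natural open set `logPolydiscOfRecord` (log-polydisc ∩ `‖𝔄ᶜ‖ < a`) containing the averaged background's datum; hence
  ★ the chart matrix entries `x ↦ (chartCfg (u x))(b)` are `Cⁿ` at `x₀` (the junction's `hC`∕`hdiff`), and (s-exp) along `u` at `U₀ = 1` in eventual form,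
  all modulo the DISPLAYED tokens (`RegimeTok`, `WAnalyticTok`, eventual `LieTokAt` along `u` — the last is the reality programme's output through
  `BgScheme.lieTokAt_of_rows`, inhabited hypothesis-free only at the flat datum).

HONEST.  Theorems over the tree's definitions plus ONE open-set definition with body; nothing of [B11] asserted; the tokens stay displayed; no row of
the reality programme is discharged here; `N = 2` is where the consumers live (at `N ≥ 3` the tree's current letter keeps a scalar channel and the
`J`-row is displayed).  Not continuum, not OS, not Clay.
-/

noncomputable section

open scoped Matrix Matrix.Norms.L2Operator InnerProductSpace ComplexConjugate Topology

namespace Literature.MathematicalPhysics.QuantumFieldTheory.Balaban1983to89.Node00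

open _root_.Filter
open T4Continuum BlockAveraging
open NormedSpace (exp)
open B11Eq103H1Complex (BondL2K SiteL2K)
open B11Eq115Space (Space115 NegSize NegSup JetSup levWeight)
open B11Eq174Chart (Regime solA)

section Record

variable (F : T4Family) (N : ℕ) [NeZero N] (K : ℕ) (k : ℕ) (Ω : ℕ → Set (Site (F.P K) 0)) (U₀ : GaugeField (F.P K) 0 (SU N))

/-- `Ū^k(1) = 1` for the averaging of record (every level map fixes the unit configuration). [cite: Balaban1987RG1, (0.4) p.253 (bookkeeping)] -/
theorem avOfRecord_iter_one : Averaging.iter (avOfRecord F N K) k (1 : GaugeField (F.P K) 0 (SU N)) = 1 :=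
  iter_one (avOfRecord F N K) (fun i => avOfRecord_avg_one (F := F) (N := N) K i) k

variable [Fact (0 < (F.L : ℝ))] [Fact (0 < (F.P K).eta k)] [Fact (0 < c0Rec F K k)] [Fact (∀ c, 0 < wBRec F K k c)]

variable (dom : Set (GaugeField (F.P K) k (SU N))) (levB : PBond (F.P K) k → ℕ)
  (Gp : SiteL2K ℂ (F.P K).d (fun _ => (F.P K).sitesPerDir 0) (c0Rec F K k) (WRec N) →ₗ[ℂ]
    SiteL2K ℂ (F.P K).d (fun _ => (F.P K).sitesPerDir 0) (c0Rec F K k) (WRec N))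
  (Δ2 : BondL2K ℂ (F.P K).d (fun _ => (F.P K).sitesPerDir 0) (c0Rec F K k) (WRec N) →ₗ[ℂ]
    BondL2K ℂ (F.P K).d (fun _ => (F.P K).sitesPerDir 0) (c0Rec F K k) (WRec N)) (a : ℝ)
  (hposπ : ∀ x, x ≠ 0 → 0 < RCLike.re ⟪x, laplaceAOfRecordAt F N k U₀ (hessOpOfRecord128 F N k U₀ Gp (QflatOfRecord F N k) Δ2)
    (QOfRecord F N k U₀) (QflatOfRecord F N k) a x⟫_ℂ)
  (hposb : ∀ x, x ≠ 0 → 0 < RCLike.re ⟪x, laplaceAOfRecord F N k U₀ (QOfRecord F N k U₀) (QflatOfRecord F N k) a x⟫_ℂ)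
  (hQ : Function.Surjective (QOfRecord F N k U₀)) (εC B₀ C₄ a₃ j a𝔄 ε₄ : ℝ)

/-! ## §1. The analytic premises of the generic file at the record -/

/-- **The presentation `ev = η·evLit` of the scheme of record is continuous** (a linear map on the finite-dimensional (115)-space).
[cite: Balaban1985Variational, (19) p.281, (115) p.294 (bookkeeping)] -/
theorem bgSchemeOfRecord_continuous_ev :
    Continuous (bgSchemeOfRecord F N K k Ω U₀ dom levB Gp Δ2 a hposπ hposb hQ εC B₀ C₄ a₃ j a𝔄 ε₄).ev :=
  LinearMap.continuous_of_finiteDimensional _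

/-- The `ev`-presented real sector of the scheme of record is closed (finite dimension). [cite: Balaban1985Variational, (115) p.294 (bookkeeping)] -/
theorem bgSchemeOfRecord_isClosed_evHerm0 :
    IsClosed ((bgSchemeOfRecord F N K k Ω U₀ dom levB Gp Δ2 a hposπ hposb hQ εC B₀ C₄ a₃ j a𝔄 ε₄).evHerm0 :
      Set (Space115Lit F N K k Ω U₀)) :=
  BgScheme.isClosed_evHerm0

/-! ## §3. Cⁿ of the full small field along a datum map, from (s1)'s analyticity -/

/-- **THE NATURAL OPEN SET OF COMPLEX DATA**: the log-polydisc around the averaged background `‖Z(c)(Ū^kU₀)(c)⋆ − 1‖ < 1` (where `Bᶜ`, `𝔄ᶜ` are analytic)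
cut by the shift bound `‖𝔄ᶜ(Z)‖ < a` of Prop. 6. [cite: Balaban1985Variational, Sect. G p.307, Prop. 6 p.295, (115) p.294, Prop. 9 p.309] -/
def logPolydiscOfRecord : Set (PBond (F.P K) k → Matrix (Fin N) (Fin N) ℂ) :=
  {Z | ∀ c : PBond (F.P K) k, ‖Z c * star (Averaging.iter (avOfRecord F N K) k U₀ c : Matrix (Fin N) (Fin N) ℂ) - 1‖ < 1} ∩
    {Z | ‖frakAOfRecordAtBg128C F N K k Ω U₀ levB Gp Δ2 a hposπ hQ Z‖ < a𝔄}

/-- The log-polydisc condition holds on `logPolydiscOfRecord`. [cite: Balaban1985Variational, Sect. G p.307 (bookkeeping)] -/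
theorem logPolydiscOfRecord_log {Z : PBond (F.P K) k → Matrix (Fin N) (Fin N) ℂ}
    (hZ : Z ∈ logPolydiscOfRecord F N K k Ω U₀ levB Gp Δ2 a hposπ hQ a𝔄) (c : PBond (F.P K) k) :
    ‖Z c * star (Averaging.iter (avOfRecord F N K) k U₀ c : Matrix (Fin N) (Fin N) ℂ) - 1‖ < 1 :=
  hZ.1 c

/-- The shift bound holds on `logPolydiscOfRecord`. [cite: Balaban1985Variational, Prop. 6 (115) p.294 (bookkeeping)] -/
theorem logPolydiscOfRecord_frakA {Z : PBond (F.P K) k → Matrix (Fin N) (Fin N) ℂ}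
    (hZ : Z ∈ logPolydiscOfRecord F N K k Ω U₀ levB Gp Δ2 a hposπ hQ a𝔄) :
    ‖frakAOfRecordAtBg128C F N K k Ω U₀ levB Gp Δ2 a hposπ hQ Z‖ < a𝔄 :=
  hZ.2

/-- `logPolydiscOfRecord` is OPEN (the polydisc is a finite intersection of open sets; `𝔄ᶜ` is continuous on it). [cite: Balaban1985Variational, Sect. G p.307 (bookkeeping)] -/
theorem isOpen_logPolydiscOfRecord : IsOpen (logPolydiscOfRecord F N K k Ω U₀ levB Gp Δ2 a hposπ hQ a𝔄) := by
  have hpoly : IsOpen {Z : PBond (F.P K) k → Matrix (Fin N) (Fin N) ℂ |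
      ∀ c : PBond (F.P K) k, ‖Z c * star (Averaging.iter (avOfRecord F N K) k U₀ c : Matrix (Fin N) (Fin N) ℂ) - 1‖ < 1} := by
    rw [show {Z : PBond (F.P K) k → Matrix (Fin N) (Fin N) ℂ |
        ∀ c : PBond (F.P K) k, ‖Z c * star (Averaging.iter (avOfRecord F N K) k U₀ c : Matrix (Fin N) (Fin N) ℂ) - 1‖ < 1} =
        ⋂ c : PBond (F.P K) k, {Z | ‖Z c * star (Averaging.iter (avOfRecord F N K) k U₀ c : Matrix (Fin N) (Fin N) ℂ) - 1‖ < 1} from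
      Set.ext fun Z => by simp only [Set.mem_setOf_eq, Set.mem_iInter]]
    exact isOpen_iInter_of_finite fun c =>
      isOpen_lt (((continuous_apply c).mul continuous_const).sub continuous_const).norm continuous_const
  have hcont : ContinuousOn (fun Z => ‖frakAOfRecordAtBg128C F N K k Ω U₀ levB Gp Δ2 a hposπ hQ Z‖)
      {Z : PBond (F.P K) k → Matrix (Fin N) (Fin N) ℂ |
        ∀ c : PBond (F.P K) k, ‖Z c * star (Averaging.iter (avOfRecord F N K) k U₀ c : Matrix (Fin N) (Fin N) ℂ) - 1‖ < 1} :=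
    fun Z hZ => ((analyticAt_frakAOfRecordAtBg128C F N K k Ω U₀ levB Gp Δ2 a hposπ hQ hZ).continuousAt.norm).continuousWithinAt
  exact hcont.isOpen_inter_preimage hpoly isOpen_Iio

/-- **The averaged background's own datum lies in `logPolydiscOfRecord`** (`Ū^kU₀ · (Ū^kU₀)⋆ = 1`, `𝔄ᶜ(Ū^kU₀) = 0 < a`). At `U₀ = 1` this is the flat
datum `coeField 1`. [cite: Balaban1985Variational, (20) p.281, (103) p.293, Prop. 6 p.295] -/
theorem coeField_iter_mem_logPolydiscOfRecord (ha : 0 < a𝔄) :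
    coeField (Averaging.iter (avOfRecord F N K) k U₀) ∈ logPolydiscOfRecord F N K k Ω U₀ levB Gp Δ2 a hposπ hQ a𝔄 := by
  refine ⟨fun c => ?_, ?_⟩
  · rw [coeField_apply, coe_mul_star_coe_SU, sub_self, norm_zero]
    exact one_pos
  · show ‖frakAOfRecordAtBg128C F N K k Ω U₀ levB Gp Δ2 a hposπ hQ (coeField (Averaging.iter (avOfRecord F N K) k U₀))‖ < a𝔄
    rw [frakAOfRecordAtBg128C_self, norm_zero]
    exact ha

variable {E : Type*} [NormedAddCommGroup E] [NormedSpace ℝ E]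

/-- **★ Cⁿ OF THE FULL SMALL FIELD `x ↦ 𝒜(u x) + 𝔄(u x)` ALONG A DATUM MAP** from (s1)'s ℂ-analyticity of `𝒜ᶜ` on an open set `𝒪` of complex data
inside the log-polydisc and the `Cⁿ` class of the coefficient field `x ↦ coeField (u x)` (reality: `𝒜ᶜ ∘ coeField = 𝒜`, `𝔄ᶜ ∘ coeField = 𝔄`, `rfl`).
[cite: Balaban1985Variational, Prop. 9 p.309, Prop. 6 (116) p.295] -/
theorem bgSchemeOfRecord_contDiffAt_sol_add_shift_comp {n : WithTop ℕ∞} {𝒪 : Set (PBond (F.P K) k → Matrix (Fin N) (Fin N) ℂ)}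
    (hsol : AnalyticOnNhd ℂ (solOfRecordC F N K k Ω U₀ levB Gp Δ2 a hposπ hposb hQ εC ε₄) 𝒪)
    (hlog : ∀ Z ∈ 𝒪, ∀ c : PBond (F.P K) k, ‖Z c * star (Averaging.iter (avOfRecord F N K) k U₀ c : Matrix (Fin N) (Fin N) ℂ) - 1‖ < 1)
    {u : E → GaugeField (F.P K) k (SU N)} {x₀ : E} (hu : ContDiffAt ℝ n (fun x => coeField (u x)) x₀) (hx₀ : coeField (u x₀) ∈ 𝒪) :
    ContDiffAt ℝ n (fun x => (bgSchemeOfRecord F N K k Ω U₀ dom levB Gp Δ2 a hposπ hposb hQ εC B₀ C₄ a₃ j a𝔄 ε₄).sol (u x) +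
      (bgSchemeOfRecord F N K k Ω U₀ dom levB Gp Δ2 a hposπ hposb hQ εC B₀ C₄ a₃ j a𝔄 ε₄).𝔄 (u x)) x₀ := by
  have h1 : ContDiffAt ℝ n (fun x => solOfRecordC F N K k Ω U₀ levB Gp Δ2 a hposπ hposb hQ εC ε₄ (coeField (u x))) x₀ :=
    ContDiffAt.comp (g := solOfRecordC F N K k Ω U₀ levB Gp Δ2 a hposπ hposb hQ εC ε₄) (f := fun x => coeField (u x)) x₀
      ((hsol _ hx₀).contDiffAt.restrict_scalars ℝ) hu
  have h2 : ContDiffAt ℝ n (fun x => frakAOfRecordAtBg128C F N K k Ω U₀ levB Gp Δ2 a hposπ hQ (coeField (u x))) x₀ :=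
    ContDiffAt.comp (g := frakAOfRecordAtBg128C F N K k Ω U₀ levB Gp Δ2 a hposπ hQ) (f := fun x => coeField (u x)) x₀
      ((analyticAt_frakAOfRecordAtBg128C F N K k Ω U₀ levB Gp Δ2 a hposπ hQ (hlog _ hx₀)).contDiffAt.restrict_scalars ℝ) hu
  show ContDiffAt ℝ n (fun x => solOfRecordC F N K k Ω U₀ levB Gp Δ2 a hposπ hposb hQ εC ε₄ (coeField (u x)) +
    frakAOfRecordAtBg128C F N K k Ω U₀ levB Gp Δ2 a hposπ hQ (coeField (u x))) x₀
  exact h1.add h2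

/-- The same from the DISPLAYED tokens: the regime `RegimeTok` (read at any `V₀ ∈ dom`), Prop. 4's analyticity `WAnalyticTok`, on the natural open set
`logPolydiscOfRecord`. [cite: Balaban1985Variational, Prop. 9 p.309, Prop. 6 (116)–(121) p.295, Prop. 4 p.292] -/
theorem bgSchemeOfRecord_contDiffAt_sol_add_shift_comp_of_regimeTok {n : WithTop ℕ∞}
    (hT : (bgSchemeOfRecord F N K k Ω U₀ dom levB Gp Δ2 a hposπ hposb hQ εC B₀ C₄ a₃ j a𝔄 ε₄).RegimeTok)
    {V₀ : GaugeField (F.P K) k (SU N)} (hV₀ : V₀ ∈ dom) (hW : WAnalyticTok F N K k Ω U₀ levB Gp a hposb hQ εC a₃)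
    {u : E → GaugeField (F.P K) k (SU N)} {x₀ : E} (hu : ContDiffAt ℝ n (fun x => coeField (u x)) x₀)
    (hx₀ : coeField (u x₀) ∈ logPolydiscOfRecord F N K k Ω U₀ levB Gp Δ2 a hposπ hQ a𝔄) :
    ContDiffAt ℝ n (fun x => (bgSchemeOfRecord F N K k Ω U₀ dom levB Gp Δ2 a hposπ hposb hQ εC B₀ C₄ a₃ j a𝔄 ε₄).sol (u x) +
      (bgSchemeOfRecord F N K k Ω U₀ dom levB Gp Δ2 a hposπ hposb hQ εC B₀ C₄ a₃ j a𝔄 ε₄).𝔄 (u x)) x₀ :=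
  bgSchemeOfRecord_contDiffAt_sol_add_shift_comp F N K k Ω U₀ dom levB Gp Δ2 a hposπ hposb hQ εC B₀ C₄ a₃ j a𝔄 ε₄
    (analyticOnNhd_solOfRecordC_of_regimeTok F N K k Ω U₀ levB Gp Δ2 a hposπ hposb hQ hT hV₀
      (isOpen_logPolydiscOfRecord F N K k Ω U₀ levB Gp Δ2 a hposπ hQ a𝔄) (fun _ hZ => hZ.2) (fun _ hZ => hZ.1) hW)
    (fun _ hZ => hZ.1) hu hx₀

/-- **★ Cⁿ OF THE CHART MATRIX ENTRIES ALONG A DATUM MAP AT THE RECORD** (◆'s `hC`∕`hdiff`): from the tokens, the `Cⁿ` coefficient field, the datum in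
`logPolydiscOfRecord`, and the Lie token eventually along `u` (the reality programme's output; at the flat datum it holds trivially).
[cite: Balaban1985Variational, Prop. 9 p.309, (15) p.280] -/
theorem bgSchemeOfRecord_contDiffAt_coe_chartCfg_comp_pi {n : WithTop ℕ∞}
    (hT : (bgSchemeOfRecord F N K k Ω U₀ dom levB Gp Δ2 a hposπ hposb hQ εC B₀ C₄ a₃ j a𝔄 ε₄).RegimeTok)
    {V₀ : GaugeField (F.P K) k (SU N)} (hV₀ : V₀ ∈ dom) (hW : WAnalyticTok F N K k Ω U₀ levB Gp a hposb hQ εC a₃)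
    {u : E → GaugeField (F.P K) k (SU N)} {x₀ : E} (hu : ContDiffAt ℝ n (fun x => coeField (u x)) x₀)
    (hx₀ : coeField (u x₀) ∈ logPolydiscOfRecord F N K k Ω U₀ levB Gp Δ2 a hposπ hQ a𝔄)
    (htok : ∀ᶠ x in 𝓝 x₀, (bgSchemeOfRecord F N K k Ω U₀ dom levB Gp Δ2 a hposπ hposb hQ εC B₀ C₄ a₃ j a𝔄 ε₄).LieTokAt (u x)) :
    ContDiffAt ℝ n (fun x (b : PBond (F.P K) 0) =>
      (((bgSchemeOfRecord F N K k Ω U₀ dom levB Gp Δ2 a hposπ hposb hQ εC B₀ C₄ a₃ j a𝔄 ε₄).chartCfg (u x) b : SU N) :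
        Matrix (Fin N) (Fin N) ℂ)) x₀ :=
  BgScheme.contDiffAt_coe_chartCfg_comp_pi
    (bgSchemeOfRecord_continuous_ev F N K k Ω U₀ dom levB Gp Δ2 a hposπ hposb hQ εC B₀ C₄ a₃ j a𝔄 ε₄) (U₀ := U₀) (fun _ => rfl) htok
    (bgSchemeOfRecord_contDiffAt_sol_add_shift_comp_of_regimeTok F N K k Ω U₀ dom levB Gp Δ2 a hposπ hposb hQ εC B₀ C₄ a₃ j a𝔄 ε₄
      hT hV₀ hW hu hx₀)

/-- Cⁿ of the Lie reading `x ↦ lieExpo (u x)` along a datum map at the record (the socket's `X := lieExpo ∘ datum`, its `DifferentiableAt ℝ X x₀`).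
[cite: Balaban1985Variational, Prop. 9 p.309, (15) p.280] -/
theorem bgSchemeOfRecord_contDiffAt_lieExpo_comp {n : WithTop ℕ∞}
    (hT : (bgSchemeOfRecord F N K k Ω U₀ dom levB Gp Δ2 a hposπ hposb hQ εC B₀ C₄ a₃ j a𝔄 ε₄).RegimeTok)
    {V₀ : GaugeField (F.P K) k (SU N)} (hV₀ : V₀ ∈ dom) (hW : WAnalyticTok F N K k Ω U₀ levB Gp a hposb hQ εC a₃)
    {u : E → GaugeField (F.P K) k (SU N)} {x₀ : E} (hu : ContDiffAt ℝ n (fun x => coeField (u x)) x₀)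
    (hx₀ : coeField (u x₀) ∈ logPolydiscOfRecord F N K k Ω U₀ levB Gp Δ2 a hposπ hQ a𝔄) :
    ContDiffAt ℝ n (fun x => (bgSchemeOfRecord F N K k Ω U₀ dom levB Gp Δ2 a hposπ hposb hQ εC B₀ C₄ a₃ j a𝔄 ε₄).lieExpo (u x)) x₀ :=
  BgScheme.contDiffAt_lieExpo_comp
    (bgSchemeOfRecord_continuous_ev F N K k Ω U₀ dom levB Gp Δ2 a hposπ hposb hQ εC B₀ C₄ a₃ j a𝔄 ε₄)
    (bgSchemeOfRecord_contDiffAt_sol_add_shift_comp_of_regimeTok F N K k Ω U₀ dom levB Gp Δ2 a hposπ hposb hQ εC B₀ C₄ a₃ j a𝔄 ε₄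
      hT hV₀ hW hu hx₀)

end Record

/-! ## §2. The flat datum at the unit background `U₀ = 1` -/

section Flat

variable (F : T4Family) (N : ℕ) [NeZero N] (K : ℕ) (k : ℕ) (Ω : ℕ → Set (Site (F.P K) 0))
variable [Fact (0 < (F.L : ℝ))] [Fact (0 < (F.P K).eta k)] [Fact (0 < c0Rec F K k)] [Fact (∀ c, 0 < wBRec F K k c)]
variable (dom : Set (GaugeField (F.P K) k (SU N))) (levB : PBond (F.P K) k → ℕ)
  (Gp : SiteL2K ℂ (F.P K).d (fun _ => (F.P K).sitesPerDir 0) (c0Rec F K k) (WRec N) →ₗ[ℂ]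
    SiteL2K ℂ (F.P K).d (fun _ => (F.P K).sitesPerDir 0) (c0Rec F K k) (WRec N))
  (Δ2 : BondL2K ℂ (F.P K).d (fun _ => (F.P K).sitesPerDir 0) (c0Rec F K k) (WRec N) →ₗ[ℂ]
    BondL2K ℂ (F.P K).d (fun _ => (F.P K).sitesPerDir 0) (c0Rec F K k) (WRec N)) (a : ℝ)
  (hposπ : ∀ x, x ≠ 0 → 0 < RCLike.re ⟪x, laplaceAOfRecordAt F N k (1 : GaugeField (F.P K) 0 (SU N))
    (hessOpOfRecord128 F N k (1 : GaugeField (F.P K) 0 (SU N)) Gp (QflatOfRecord F N k) Δ2)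
    (QOfRecord F N k (1 : GaugeField (F.P K) 0 (SU N))) (QflatOfRecord F N k) a x⟫_ℂ)
  (hposb : ∀ x, x ≠ 0 → 0 < RCLike.re ⟪x, laplaceAOfRecord F N k (1 : GaugeField (F.P K) 0 (SU N))
    (QOfRecord F N k (1 : GaugeField (F.P K) 0 (SU N))) (QflatOfRecord F N k) a x⟫_ℂ)
  (hQ : Function.Surjective (QOfRecord F N k (1 : GaugeField (F.P K) 0 (SU N)))) (εC B₀ C₄ a₃ j a𝔄 ε₄ : ℝ)

/-- **`𝔄(1) = 0` at the unit background** (E2 `𝔄(Ū^kU₀) = 0` with `Ū^k(1) = 1`). [cite: Balaban1985Variational, (20) p.281, (103) p.293] -/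
theorem bgSchemeOfRecord_𝔄_one :
    (bgSchemeOfRecord F N K k Ω 1 dom levB Gp Δ2 a hposπ hposb hQ εC B₀ C₄ a₃ j a𝔄 ε₄).𝔄 1 = 0 := by
  have h := bgSchemeOfRecord_𝔄_self F N K k Ω 1 dom levB Gp Δ2 a hposπ hposb hQ εC B₀ C₄ a₃ j a𝔄 ε₄
  rwa [avOfRecord_iter_one] at h

/-- **★ `𝒜(1) = 0`: THE FIXED POINT VANISHES AT THE FLAT DATUM** (zero current, zero shift; uniqueness in the regime — DISPLAYED `RegimeTok`, `1 ∈ dom`).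
[cite: Balaban1985Variational, Prop. 6 (116) p.295, Prop. 9 p.309] -/
theorem bgSchemeOfRecord_sol_one (hT : (bgSchemeOfRecord F N K k Ω 1 dom levB Gp Δ2 a hposπ hposb hQ εC B₀ C₄ a₃ j a𝔄 ε₄).RegimeTok)
    (h1 : (1 : GaugeField (F.P K) k (SU N)) ∈ dom) :
    (bgSchemeOfRecord F N K k Ω 1 dom levB Gp Δ2 a hposπ hposb hQ εC B₀ C₄ a₃ j a𝔄 ε₄).sol 1 = 0 := by
  obtain ⟨R, hJ, h𝔄⟩ := hT 1 h1
  exact BgScheme.sol_eq_zero R ((norm_nonneg _).trans hJ) ((norm_nonneg _).trans_lt h𝔄)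
    (bgSchemeOfRecord_J_one F N K k Ω dom levB Gp Δ2 a hposπ hposb hQ εC B₀ C₄ a₃ j a𝔄 ε₄ 1)
    (bgSchemeOfRecord_𝔄_one F N K k Ω dom levB Gp Δ2 a hposπ hposb hQ εC B₀ C₄ a₃ j a𝔄 ε₄)

/-- The Lie token holds at the flat datum (zero exponent). [cite: Balaban1985Variational, (15) p.280, Prop. 9 p.309] -/
theorem bgSchemeOfRecord_lieTokAt_one (hT : (bgSchemeOfRecord F N K k Ω 1 dom levB Gp Δ2 a hposπ hposb hQ εC B₀ C₄ a₃ j a𝔄 ε₄).RegimeTok)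
    (h1 : (1 : GaugeField (F.P K) k (SU N)) ∈ dom) :
    (bgSchemeOfRecord F N K k Ω 1 dom levB Gp Δ2 a hposπ hposb hQ εC B₀ C₄ a₃ j a𝔄 ε₄).LieTokAt 1 :=
  BgScheme.lieTokAt_of_sol_eq_zero (bgSchemeOfRecord_sol_one F N K k Ω dom levB Gp Δ2 a hposπ hposb hQ εC B₀ C₄ a₃ j a𝔄 ε₄ hT h1)
    (bgSchemeOfRecord_𝔄_one F N K k Ω dom levB Gp Δ2 a hposπ hposb hQ εC B₀ C₄ a₃ j a𝔄 ε₄)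

/-- The Lie reading vanishes at the flat datum: `lieExpo 1 = 0`. [cite: Balaban1985Variational, (15) p.280, Prop. 9 p.309] -/
theorem bgSchemeOfRecord_lieExpo_one (hT : (bgSchemeOfRecord F N K k Ω 1 dom levB Gp Δ2 a hposπ hposb hQ εC B₀ C₄ a₃ j a𝔄 ε₄).RegimeTok)
    (h1 : (1 : GaugeField (F.P K) k (SU N)) ∈ dom) :
    (bgSchemeOfRecord F N K k Ω 1 dom levB Gp Δ2 a hposπ hposb hQ εC B₀ C₄ a₃ j a𝔄 ε₄).lieExpo 1 = 0 :=
  BgScheme.lieExpo_eq_zero (bgSchemeOfRecord_sol_one F N K k Ω dom levB Gp Δ2 a hposπ hposb hQ εC B₀ C₄ a₃ j a𝔄 ε₄ hT h1)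
    (bgSchemeOfRecord_𝔄_one F N K k Ω dom levB Gp Δ2 a hposπ hposb hQ εC B₀ C₄ a₃ j a𝔄 ε₄)

/-- **★★ `chartCfg 1 = 1`: THE CHART IMAGE OF THE FIXED POINT AT THE FLAT DATUM IS THE FLAT CONFIGURATION** — the K0 junction's `h1`
(`…K0AxJunctionRootGradScheme`), modulo the DISPLAYED `RegimeTok` and `1 ∈ dom`. [cite: Balaban1985Variational, (15) p.280, Prop. 9 p.309] -/
theorem bgSchemeOfRecord_chartCfg_one (hT : (bgSchemeOfRecord F N K k Ω 1 dom levB Gp Δ2 a hposπ hposb hQ εC B₀ C₄ a₃ j a𝔄 ε₄).RegimeTok)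
    (h1 : (1 : GaugeField (F.P K) k (SU N)) ∈ dom) :
    (bgSchemeOfRecord F N K k Ω 1 dom levB Gp Δ2 a hposπ hposb hQ εC B₀ C₄ a₃ j a𝔄 ε₄).chartCfg 1 = 1 := by
  rw [BgScheme.chartCfg_eq_bg (bgSchemeOfRecord_sol_one F N K k Ω dom levB Gp Δ2 a hposπ hposb hQ εC B₀ C₄ a₃ j a𝔄 ε₄ hT h1)
    (bgSchemeOfRecord_𝔄_one F N K k Ω dom levB Gp Δ2 a hposπ hposb hQ εC B₀ C₄ a₃ j a𝔄 ε₄)]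
  rfl

/-- **(s-exp) AT THE RECORD, `U₀ = 1`, eventual form along a datum map**: `chartCfg ∘ u =ᶠ[l] (x ↦ expChart 1 (lieExpo (u x)))` whenever the Lie token
holds eventually along `u` (the reality programme's output through `BgScheme.lieTokAt_of_rows`). [cite: Balaban1985Variational, (15) p.280, (19) p.281] -/
theorem bgSchemeOfRecord_chartCfg_comp_eventuallyEq_expChart {E : Type*} {l : Filter E} {u : E → GaugeField (F.P K) k (SU N)}
    (htok : ∀ᶠ x in l, (bgSchemeOfRecord F N K k Ω 1 dom levB Gp Δ2 a hposπ hposb hQ εC B₀ C₄ a₃ j a𝔄 ε₄).LieTokAt (u x)) :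
    (fun x => (bgSchemeOfRecord F N K k Ω 1 dom levB Gp Δ2 a hposπ hposb hQ εC B₀ C₄ a₃ j a𝔄 ε₄).chartCfg (u x)) =ᶠ[l]
      fun x => expChart 1 ((bgSchemeOfRecord F N K k Ω 1 dom levB Gp Δ2 a hposπ hposb hQ εC B₀ C₄ a₃ j a𝔄 ε₄).lieExpo (u x)) :=
  BgScheme.chartCfg_comp_eventuallyEq_expChart (fun _ => rfl) htok

/-- **The flat datum lies in `logPolydiscOfRecord` at `U₀ = 1`** (`coeField 1`; needs only `0 < a`). [cite: Balaban1985Variational, (20) p.281, Prop. 6 p.295] -/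
theorem coeField_one_mem_logPolydiscOfRecord (ha : 0 < a𝔄) :
    coeField (1 : GaugeField (F.P K) k (SU N)) ∈ logPolydiscOfRecord F N K k Ω 1 levB Gp Δ2 a hposπ hQ a𝔄 := by
  have h := coeField_iter_mem_logPolydiscOfRecord F N K k Ω 1 levB Gp Δ2 a hposπ hQ a𝔄 ha
  rwa [avOfRecord_iter_one] at h

end Flat

end Literature.MathematicalPhysics.QuantumFieldTheory.Balaban1983to89.Node00
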